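import Literature.AlgebraicGeometry.Kloosterman2025.TwoPlanesNormalForm
import Literature.AlgebraicGeometry.Kloosterman2025.CodimOneHodgeLociAllDegrees
import HarnessLib

/-!
# The census cells and the remaining "every `X`" theorems of the Kloosterman cluster, for EVERY hypersurface
# containing the two planes (consequences of the normal form, Kloosterman 2025 §4 p. 10 / Remark 5.2)

R. Kloosterman, *On a conjecture on Hodge loci of linear combinations of linear subvarieties*, Rend. Circ. Mat. Palermo
(2) 74 (2025) = arXiv:2312.12363 [cite: Kloosterman2025]; *Hodge loci associated with linear subspaces intersecting in
codimension one*, Math. Nachr. 298 (2025) = arXiv:2401.10775 [cite: Kloosterman2025CodimOne].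

`TwoPlanesNormalForm.lean` proves that every form `F` of degree `d ≥ 2` in `I(Π₁) ∩ I(Π₂)` (two `k`-planes cut out by
linearly independent linear forms `g, h, g'`) IS a `twoPlanesForm g h g' Q P` (`exists_twoPlanesForm_eq_of_mem`). This
file spells out the resulting "for every `X ⊇ Π₁ ∪ Π₂`" versions of the theorems of `ExcessTangentDimensionLowerBound.lean`
and `CodimOneHodgeLociAllDegrees.lean` that were stated for `F` GIVEN in normal form (each: `∃ Q P`, `F = twoPlanesForm …`
AND the tree's conclusion): `twoPlanes_ker_eq_comap_inf_of_lt_of_mem` (Example 3.16 first half / Cor. 3.14: NO excess when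
`r(d−2) < β`), the census cells `cubicEightfold_twoFourPlanes_line_idealDegree_inf_lt_of_mem` (`(8,3,1)`: excess ≥ 1 for
every `λ` at every `X`), `cubicEightfold_twoFourPlanes_line_hilbert_inf_of_mem` (`codim T_X NL(Π₁,Π₂) = 20`),
`cubicSixfold_twoThreePlanes_line_two_le_excess_of_mem` (`(6,3,1)`: excess ≥ 2), `quarticFourfold_twoPlanes_point_idealDegree_inf_lt_of_mem`
(`(4,4,0)`), `coplanarLines_idealDegree_inf_lt_of_mem` ([KloMN] Prop. 3.1, Dan: surfaces with two coplanar lines, `d ≥ 4`,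
excess for every `λ` and `codim T_X NL([Π₁],[Π₂]) = 2d−6`), `remark_4_9_codimOne_of_mem` ([KloMN] Remark 4.9). Theorems
1.3 / Prop. 3.9 in general form are `twoPlanes_idealDegree_inf_lt_of_mem` / `twoPlanes_hilbert_inf_eq_intdim_of_mem` in
`TwoPlanesNormalForm.lean`. 0 facts, 0 sorry; the Hodge-theoretic dictionary is NOT formalised (as in all companion files).

HONEST FRAMING (cell pub-hlocus): certified instances and evidence bearing on the general Hodge conjecture; no claim.
-/

noncomputable section

open MvPolynomial Module Literature.RingTheory.MvPolynomial

namespace Literature.AlgebraicGeometry.Kloosterman2025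

open Literature.AlgebraicGeometry.Kloosterman2023 Literature.AlgebraicGeometry.HodgeTheory
  Literature.AlgebraicGeometry.Motives.UniversalHypersurface

/-! ## The census cells and the remaining "every `X`" theorems, for every `F ∈ I(Π₁) ∩ I(Π₂)` -/

section EveryX

variable {K : Type*} [Field K] {k c r : ℕ}

/-- **Example 3.16, first half / Cor. 3.14 — NO excess — for EVERY hypersurface `X = V(F) ⊇ Π₁ ∪ Π₂`** with
finite-dimensional Jacobian ring: if `r(d−2) < β` (`α + β = (k+1)(d−2)`), then for every socle functional `ℓ` of `J^F`
and every `c₀ ≠ 0` the left kernel of the pencil member on `S_α × S_β` is `(I(Π₁) ∩ I(Π₂))_α` (tree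
`twoPlanes_ker_eq_comap_inf_of_lt` + the normal form `exists_twoPlanesForm_eq_of_mem`).
[cite: Kloosterman2025, Example 3.16, Corollary 3.14, §4 (p. 10)] -/
theorem twoPlanes_ker_eq_comap_inf_of_lt_of_mem {d : ℕ} (hd : 2 ≤ d) (κ : Fin c ⊕ Fin r ≃ Fin (k + 1))
    (gA h : Fin c → MvPolynomial (Fin (2 * k + 2)) K) (gC : Fin r → MvPolynomial (Fin (2 * k + 2)) K)
    (hgA : ∀ i, (gA i).IsHomogeneous 1) (hh : ∀ j, (h j).IsHomogeneous 1) (hgC : ∀ m, (gC m).IsHomogeneous 1)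
    (hli : LinearIndependent K (Sum.elim (Sum.elim gA h) gC)) {F : MvPolynomial (Fin (2 * k + 2)) K}
    (hF : F.IsHomogeneous d) (hF₁ : F ∈ Ideal.span (Set.range gA ∪ Set.range gC))
    (hF₂ : F ∈ Ideal.span (Set.range h ∪ Set.range gC)) {N : ℕ} (hN : 0 < N)
    (hXN : ∀ l, (X l : MvPolynomial (Fin (2 * k + 2)) K) ^ N ∈ jacobianIdeal F)
    {ℓ : MvPolynomial (Fin (2 * k + 2)) K →ₗ[K] K}
    (hℓ : ∀ p, ℓ (homogeneousComponent ((2 * k + 2) * (d - 2)) p) = ℓ p) (hJ : annIdeal ℓ = jacobianIdeal F)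
    {α β : ℕ} (hαβ : α + β = (k + 1) * (d - 2)) (hlt : r * (d - 2) < β) {c₀ : K} (hc₀ : c₀ ≠ 0) :
    ∃ (Q : Fin c → Fin c → MvPolynomial (Fin (2 * k + 2)) K) (P : Fin r → MvPolynomial (Fin (2 * k + 2)) K),
      (∀ i j, (Q i j).IsHomogeneous (d - 2)) ∧ (∀ m, (P m).IsHomogeneous (d - 1)) ∧
      twoPlanesForm gA h gC Q P = F ∧
      LinearMap.ker (gradedMulForm
          (ciCycleFunctional ℓ (plane₁Gens κ gA gC) (plane₁Cofs κ h Q P) +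
            c₀ • ciCycleFunctional ℓ (plane₂Gens κ h gC) (plane₂Cofs κ gA Q P)) α β) =
        (idealDegree
          ((Ideal.span (Set.range (plane₁Gens κ gA gC)) ⊔ Ideal.span (Set.range (plane₁Cofs κ h Q P))) ⊓
            (Ideal.span (Set.range (plane₂Gens κ h gC)) ⊔ Ideal.span (Set.range (plane₂Cofs κ gA Q P)))) α).comap
          (homogeneousSubmodule (Fin (2 * k + 2)) K α).subtype := by
  obtain ⟨Q, P, hQ, hP, rfl⟩ := exists_twoPlanesForm_eq_of_mem hd gA h gC hgA hh hgC hli hF hF₁ hF₂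
  exact ⟨Q, P, hQ, hP, rfl,
    twoPlanes_ker_eq_comap_inf_of_lt hd κ gA h gC Q P hgA hh hgC hQ hP hN hXN hℓ hJ hαβ hlt hc₀⟩

/-- **Census cell `(8,3,1)` at EVERY cubic eightfold containing two `4`-planes meeting along a line** (`c = 3`,
`r = 2`), finite-dimensional Jacobian ring, every socle functional, every `c₀`: the cubic IS in normal form and
`(I(Π₁) ∩ I(Π₂))_3 ⊊ I(ℓ₁ + c₀ℓ₂)_3` — the census input "(F1): `e(X;λ) ≥ 1` for every `X ∈ NL(pair)`".
[cite: Kloosterman2025, Theorem 1.3, §4 (p. 10)] -/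
theorem cubicEightfold_twoFourPlanes_line_idealDegree_inf_lt_of_mem (κ : Fin 3 ⊕ Fin 2 ≃ Fin (4 + 1))
    (gA h : Fin 3 → MvPolynomial (Fin (2 * 4 + 2)) K) (gC : Fin 2 → MvPolynomial (Fin (2 * 4 + 2)) K)
    (hgA : ∀ i, (gA i).IsHomogeneous 1) (hh : ∀ j, (h j).IsHomogeneous 1) (hgC : ∀ m, (gC m).IsHomogeneous 1)
    (hli : LinearIndependent K (Sum.elim (Sum.elim gA h) gC)) {F : MvPolynomial (Fin (2 * 4 + 2)) K}
    (hF : F.IsHomogeneous 3) (hF₁ : F ∈ Ideal.span (Set.range gA ∪ Set.range gC))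
    (hF₂ : F ∈ Ideal.span (Set.range h ∪ Set.range gC)) {N : ℕ} (hN : 0 < N)
    (hXN : ∀ l, (X l : MvPolynomial (Fin (2 * 4 + 2)) K) ^ N ∈ jacobianIdeal F)
    {ℓ : MvPolynomial (Fin (2 * 4 + 2)) K →ₗ[K] K} (hℓ : ∀ p, ℓ (homogeneousComponent 10 p) = ℓ p)
    (hJ : annIdeal ℓ = jacobianIdeal F) (c₀ : K) :
    ∃ (Q : Fin 3 → Fin 3 → MvPolynomial (Fin (2 * 4 + 2)) K) (P : Fin 2 → MvPolynomial (Fin (2 * 4 + 2)) K),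
      (∀ i j, (Q i j).IsHomogeneous 1) ∧ (∀ m, (P m).IsHomogeneous 2) ∧ twoPlanesForm gA h gC Q P = F ∧
      idealDegree
          ((Ideal.span (Set.range (plane₁Gens κ gA gC)) ⊔ Ideal.span (Set.range (plane₁Cofs κ h Q P))) ⊓
            (Ideal.span (Set.range (plane₂Gens κ h gC)) ⊔ Ideal.span (Set.range (plane₂Cofs κ gA Q P)))) 3 <
        idealDegree (annIdeal (ciCycleFunctional ℓ (plane₁Gens κ gA gC) (plane₁Cofs κ h Q P) +
          c₀ • ciCycleFunctional ℓ (plane₂Gens κ h gC) (plane₂Cofs κ gA Q P))) 3 := by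
  obtain ⟨Q, P, hQ, hP, rfl⟩ := exists_twoPlanesForm_eq_of_mem (d := 3) (by norm_num) gA h gC hgA hh hgC hli hF hF₁ hF₂
  exact ⟨Q, P, hQ, hP, rfl,
    cubicEightfold_twoFourPlanes_line_idealDegree_inf_lt κ gA h gC Q P hgA hh hgC hQ hP hN hXN hℓ hJ c₀⟩

/-- `(8,3,1)` at EVERY such cubic: **`codim T_X NL(Π₁,Π₂) = 20`**. [cite: Kloosterman2025, Proposition 3.9, §4 (p. 10)] -/
theorem cubicEightfold_twoFourPlanes_line_hilbert_inf_of_mem (κ : Fin 3 ⊕ Fin 2 ≃ Fin (4 + 1))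
    (gA h : Fin 3 → MvPolynomial (Fin (2 * 4 + 2)) K) (gC : Fin 2 → MvPolynomial (Fin (2 * 4 + 2)) K)
    (hgA : ∀ i, (gA i).IsHomogeneous 1) (hh : ∀ j, (h j).IsHomogeneous 1) (hgC : ∀ m, (gC m).IsHomogeneous 1)
    (hli : LinearIndependent K (Sum.elim (Sum.elim gA h) gC)) {F : MvPolynomial (Fin (2 * 4 + 2)) K}
    (hF : F.IsHomogeneous 3) (hF₁ : F ∈ Ideal.span (Set.range gA ∪ Set.range gC))
    (hF₂ : F ∈ Ideal.span (Set.range h ∪ Set.range gC)) {N : ℕ}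
    (hXN : ∀ l, (X l : MvPolynomial (Fin (2 * 4 + 2)) K) ^ N ∈ jacobianIdeal F) :
    ∃ (Q : Fin 3 → Fin 3 → MvPolynomial (Fin (2 * 4 + 2)) K) (P : Fin 2 → MvPolynomial (Fin (2 * 4 + 2)) K),
      (∀ i j, (Q i j).IsHomogeneous 1) ∧ (∀ m, (P m).IsHomogeneous 2) ∧ twoPlanesForm gA h gC Q P = F ∧
      finrank K (homogeneousSubmodule (Fin (2 * 4 + 2)) K 3) -
          finrank K (idealDegree
            ((Ideal.span (Set.range (plane₁Gens κ gA gC)) ⊔ Ideal.span (Set.range (plane₁Cofs κ h Q P))) ⊓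
              (Ideal.span (Set.range (plane₂Gens κ h gC)) ⊔ Ideal.span (Set.range (plane₂Cofs κ gA Q P)))) 3) = 20 := by
  obtain ⟨Q, P, hQ, hP, rfl⟩ := exists_twoPlanesForm_eq_of_mem (d := 3) (by norm_num) gA h gC hgA hh hgC hli hF hF₁ hF₂
  exact ⟨Q, P, hQ, hP, rfl, cubicEightfold_twoFourPlanes_line_hilbert_inf κ gA h gC Q P hgA hh hgC hQ hP hXN⟩

/-- **Census cell `(6,3,1)` at EVERY cubic sixfold containing two `3`-planes meeting along a line** (`c = 2`, `r = 2`):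
excess `e(c₀) ≥ 2` for every `c₀`. [cite: Kloosterman2025, Theorem 1.3, §4 (p. 10)] [cite: Movasati2016Periods, §6 Table 1] -/
theorem cubicSixfold_twoThreePlanes_line_two_le_excess_of_mem (κ : Fin 2 ⊕ Fin 2 ≃ Fin (3 + 1))
    (gA h : Fin 2 → MvPolynomial (Fin (2 * 3 + 2)) K) (gC : Fin 2 → MvPolynomial (Fin (2 * 3 + 2)) K)
    (hgA : ∀ i, (gA i).IsHomogeneous 1) (hh : ∀ j, (h j).IsHomogeneous 1) (hgC : ∀ m, (gC m).IsHomogeneous 1)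
    (hli : LinearIndependent K (Sum.elim (Sum.elim gA h) gC)) {F : MvPolynomial (Fin (2 * 3 + 2)) K}
    (hF : F.IsHomogeneous 3) (hF₁ : F ∈ Ideal.span (Set.range gA ∪ Set.range gC))
    (hF₂ : F ∈ Ideal.span (Set.range h ∪ Set.range gC)) {N : ℕ} (hN : 0 < N)
    (hXN : ∀ l, (X l : MvPolynomial (Fin (2 * 3 + 2)) K) ^ N ∈ jacobianIdeal F)
    {ℓ : MvPolynomial (Fin (2 * 3 + 2)) K →ₗ[K] K} (hℓ : ∀ p, ℓ (homogeneousComponent 8 p) = ℓ p)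
    (hJ : annIdeal ℓ = jacobianIdeal F) (c₀ : K) :
    ∃ (Q : Fin 2 → Fin 2 → MvPolynomial (Fin (2 * 3 + 2)) K) (P : Fin 2 → MvPolynomial (Fin (2 * 3 + 2)) K),
      (∀ i j, (Q i j).IsHomogeneous 1) ∧ (∀ m, (P m).IsHomogeneous 2) ∧ twoPlanesForm gA h gC Q P = F ∧
      finrank K (idealDegree
          ((Ideal.span (Set.range (plane₁Gens κ gA gC)) ⊔ Ideal.span (Set.range (plane₁Cofs κ h Q P))) ⊓
            (Ideal.span (Set.range (plane₂Gens κ h gC)) ⊔ Ideal.span (Set.range (plane₂Cofs κ gA Q P)))) 3) + 2 ≤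
        finrank K (LinearMap.ker (gradedMulForm
          (ciCycleFunctional ℓ (plane₁Gens κ gA gC) (plane₁Cofs κ h Q P) +
            c₀ • ciCycleFunctional ℓ (plane₂Gens κ h gC) (plane₂Cofs κ gA Q P)) 3 1)) := by
  obtain ⟨Q, P, hQ, hP, rfl⟩ := exists_twoPlanesForm_eq_of_mem (d := 3) (by norm_num) gA h gC hgA hh hgC hli hF hF₁ hF₂
  exact ⟨Q, P, hQ, hP, rfl,
    cubicSixfold_twoThreePlanes_line_two_le_excess κ gA h gC Q P hgA hh hgC hQ hP hN hXN hℓ hJ c₀⟩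

/-- **Census cell `(4,4,0)` at EVERY quartic fourfold containing two planes meeting in a point** (`c = 2`, `r = 1`):
`(I(Π₁) ∩ I(Π₂))_4 ⊊ I(ℓ₁ + c₀ℓ₂)_4` for every `c₀`. [cite: Kloosterman2025, Theorem 1.3, §4 (p. 10)] -/
theorem quarticFourfold_twoPlanes_point_idealDegree_inf_lt_of_mem (κ : Fin 2 ⊕ Fin 1 ≃ Fin (2 + 1))
    (gA h : Fin 2 → MvPolynomial (Fin (2 * 2 + 2)) K) (gC : Fin 1 → MvPolynomial (Fin (2 * 2 + 2)) K)
    (hgA : ∀ i, (gA i).IsHomogeneous 1) (hh : ∀ j, (h j).IsHomogeneous 1) (hgC : ∀ m, (gC m).IsHomogeneous 1)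
    (hli : LinearIndependent K (Sum.elim (Sum.elim gA h) gC)) {F : MvPolynomial (Fin (2 * 2 + 2)) K}
    (hF : F.IsHomogeneous 4) (hF₁ : F ∈ Ideal.span (Set.range gA ∪ Set.range gC))
    (hF₂ : F ∈ Ideal.span (Set.range h ∪ Set.range gC)) {N : ℕ} (hN : 0 < N)
    (hXN : ∀ l, (X l : MvPolynomial (Fin (2 * 2 + 2)) K) ^ N ∈ jacobianIdeal F)
    {ℓ : MvPolynomial (Fin (2 * 2 + 2)) K →ₗ[K] K} (hℓ : ∀ p, ℓ (homogeneousComponent 12 p) = ℓ p)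
    (hJ : annIdeal ℓ = jacobianIdeal F) (c₀ : K) :
    ∃ (Q : Fin 2 → Fin 2 → MvPolynomial (Fin (2 * 2 + 2)) K) (P : Fin 1 → MvPolynomial (Fin (2 * 2 + 2)) K),
      (∀ i j, (Q i j).IsHomogeneous 2) ∧ (∀ m, (P m).IsHomogeneous 3) ∧ twoPlanesForm gA h gC Q P = F ∧
      idealDegree
          ((Ideal.span (Set.range (plane₁Gens κ gA gC)) ⊔ Ideal.span (Set.range (plane₁Cofs κ h Q P))) ⊓
            (Ideal.span (Set.range (plane₂Gens κ h gC)) ⊔ Ideal.span (Set.range (plane₂Cofs κ gA Q P)))) 4 <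
        idealDegree (annIdeal (ciCycleFunctional ℓ (plane₁Gens κ gA gC) (plane₁Cofs κ h Q P) +
          c₀ • ciCycleFunctional ℓ (plane₂Gens κ h gC) (plane₂Cofs κ gA Q P))) 4 := by
  obtain ⟨Q, P, hQ, hP, rfl⟩ := exists_twoPlanesForm_eq_of_mem (d := 4) (by norm_num) gA h gC hgA hh hgC hli hF hF₁ hF₂
  exact ⟨Q, P, hQ, hP, rfl,
    quarticFourfold_twoPlanes_point_idealDegree_inf_lt κ gA h gC Q P hgA hh hgC hQ hP hN hXN hℓ hJ c₀⟩

/-- **[KloMN] Prop. 3.1 (Dan), tangent part, for EVERY surface of degree `d ≥ 4` containing two coplanar lines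
`Π₁ = V(g, g')`, `Π₂ = V(h, g')`** (`g, h, g'` linearly independent linear forms on `ℙ³`; finite-dimensional Jacobian
ring): `F = g h Q + g' P` and `(I(Π₁) ∩ I(Π₂))_d ⊊ I(ℓ₁ + c₀ℓ₂)_d` for every socle functional `ℓ` and every `c₀`
("`T_X NL([Π₁]+λ[Π₂])/T_X NL([Π₁],[Π₂])` is nonzero for all `λ`"), with `codim T_X NL([Π₁],[Π₂]) = 2d − 6`.
[cite: Kloosterman2025CodimOne, Proposition 3.1] [cite: Kloosterman2025, §4 (p. 10)] -/
theorem coplanarLines_idealDegree_inf_lt_of_mem {d : ℕ} (hd : 4 ≤ d) (κ : Fin 1 ⊕ Fin 1 ≃ Fin (1 + 1))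
    (gA h gC : Fin 1 → MvPolynomial (Fin (2 * 1 + 2)) K)
    (hgA : ∀ i, (gA i).IsHomogeneous 1) (hh : ∀ j, (h j).IsHomogeneous 1) (hgC : ∀ m, (gC m).IsHomogeneous 1)
    (hli : LinearIndependent K (Sum.elim (Sum.elim gA h) gC)) {F : MvPolynomial (Fin (2 * 1 + 2)) K}
    (hF : F.IsHomogeneous d) (hF₁ : F ∈ Ideal.span (Set.range gA ∪ Set.range gC))
    (hF₂ : F ∈ Ideal.span (Set.range h ∪ Set.range gC)) {N : ℕ} (hN : 0 < N)
    (hXN : ∀ l, (X l : MvPolynomial (Fin (2 * 1 + 2)) K) ^ N ∈ jacobianIdeal F)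
    {ℓ : MvPolynomial (Fin (2 * 1 + 2)) K →ₗ[K] K}
    (hℓ : ∀ p, ℓ (homogeneousComponent ((2 * 1 + 2) * (d - 2)) p) = ℓ p) (hJ : annIdeal ℓ = jacobianIdeal F) (c₀ : K) :
    ∃ (Q : Fin 1 → Fin 1 → MvPolynomial (Fin (2 * 1 + 2)) K) (P : Fin 1 → MvPolynomial (Fin (2 * 1 + 2)) K),
      (∀ i j, (Q i j).IsHomogeneous (d - 2)) ∧ (∀ m, (P m).IsHomogeneous (d - 1)) ∧ twoPlanesForm gA h gC Q P = F ∧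
      idealDegree
          ((Ideal.span (Set.range (plane₁Gens κ gA gC)) ⊔ Ideal.span (Set.range (plane₁Cofs κ h Q P))) ⊓
            (Ideal.span (Set.range (plane₂Gens κ h gC)) ⊔ Ideal.span (Set.range (plane₂Cofs κ gA Q P)))) d <
        idealDegree (annIdeal (ciCycleFunctional ℓ (plane₁Gens κ gA gC) (plane₁Cofs κ h Q P) +
          c₀ • ciCycleFunctional ℓ (plane₂Gens κ h gC) (plane₂Cofs κ gA Q P))) d ∧
      finrank K (homogeneousSubmodule (Fin (2 * 1 + 2)) K d) -
          finrank K (idealDegree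
            ((Ideal.span (Set.range (plane₁Gens κ gA gC)) ⊔ Ideal.span (Set.range (plane₁Cofs κ h Q P))) ⊓
              (Ideal.span (Set.range (plane₂Gens κ h gC)) ⊔ Ideal.span (Set.range (plane₂Cofs κ gA Q P)))) d) =
        2 * d - 6 := by
  obtain ⟨Q, P, hQ, hP, rfl⟩ :=
    exists_twoPlanesForm_eq_of_mem (by omega : 2 ≤ d) gA h gC hgA hh hgC hli hF hF₁ hF₂
  exact ⟨Q, P, hQ, hP, rfl, coplanarLines_idealDegree_inf_lt κ gA h gC Q P hgA hh hgC hQ hP hN hXN hd hℓ hJ c₀,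
    coplanarLines_hilbert_inf κ gA h gC Q P hgA hh hgC hQ hP hXN (by omega)⟩

/-- **[KloMN] Remark 4.9 for EVERY `X ⊇ Π₁ ∪ Π₂` meeting in codimension one**, `(d,k) ∈ {(3,3),(3,4),(4,2),(5,2)}`:
excess for every `c₀` ("there is always excess tangent dimension"). [cite: Kloosterman2025CodimOne, Remark 4.9]
[cite: Kloosterman2025, §4 (p. 10)] -/
theorem remark_4_9_codimOne_of_mem (d k : ℕ)
    (hdk : (d = 3 ∧ k = 3) ∨ (d = 3 ∧ k = 4) ∨ (d = 4 ∧ k = 2) ∨ (d = 5 ∧ k = 2))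
    (κ : Fin 1 ⊕ Fin k ≃ Fin (k + 1))
    (gA h : Fin 1 → MvPolynomial (Fin (2 * k + 2)) K) (gC : Fin k → MvPolynomial (Fin (2 * k + 2)) K)
    (hgA : ∀ i, (gA i).IsHomogeneous 1) (hh : ∀ j, (h j).IsHomogeneous 1) (hgC : ∀ m, (gC m).IsHomogeneous 1)
    (hli : LinearIndependent K (Sum.elim (Sum.elim gA h) gC)) {F : MvPolynomial (Fin (2 * k + 2)) K}
    (hF : F.IsHomogeneous d) (hF₁ : F ∈ Ideal.span (Set.range gA ∪ Set.range gC))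
    (hF₂ : F ∈ Ideal.span (Set.range h ∪ Set.range gC)) {N : ℕ} (hN : 0 < N)
    (hXN : ∀ l, (X l : MvPolynomial (Fin (2 * k + 2)) K) ^ N ∈ jacobianIdeal F)
    {ℓ : MvPolynomial (Fin (2 * k + 2)) K →ₗ[K] K}
    (hℓ : ∀ p, ℓ (homogeneousComponent ((2 * k + 2) * (d - 2)) p) = ℓ p) (hJ : annIdeal ℓ = jacobianIdeal F) (c₀ : K) :
    ∃ (Q : Fin 1 → Fin 1 → MvPolynomial (Fin (2 * k + 2)) K) (P : Fin k → MvPolynomial (Fin (2 * k + 2)) K),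
      (∀ i j, (Q i j).IsHomogeneous (d - 2)) ∧ (∀ m, (P m).IsHomogeneous (d - 1)) ∧ twoPlanesForm gA h gC Q P = F ∧
      idealDegree
          ((Ideal.span (Set.range (plane₁Gens κ gA gC)) ⊔ Ideal.span (Set.range (plane₁Cofs κ h Q P))) ⊓
            (Ideal.span (Set.range (plane₂Gens κ h gC)) ⊔ Ideal.span (Set.range (plane₂Cofs κ gA Q P)))) d <
        idealDegree (annIdeal (ciCycleFunctional ℓ (plane₁Gens κ gA gC) (plane₁Cofs κ h Q P) +
          c₀ • ciCycleFunctional ℓ (plane₂Gens κ h gC) (plane₂Cofs κ gA Q P))) d := by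
  have hd : 2 ≤ d := by omega
  obtain ⟨Q, P, hQ, hP, rfl⟩ := exists_twoPlanesForm_eq_of_mem hd gA h gC hgA hh hgC hli hF hF₁ hF₂
  exact ⟨Q, P, hQ, hP, rfl, remark_4_9_codimOne d k hdk κ gA h gC Q P hgA hh hgC hQ hP hN hXN hℓ hJ c₀⟩

end EveryX

end Literature.AlgebraicGeometry.Kloosterman2025

end
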